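import Summits.HodgeConjecture.HodgeConjecture.Cruxes.BlochSeedDiscOne.BnCCert

/-!
# BnCCertTree (dual g11) — Δ1 of `LANDING-PATH-dual-g11.md`: a TREE-SHAPED COVER for the branch-and-cut certificate checker `BnCCert` (FORMAT v1, v7 ac9f7f6247e5)

unit `plan-lens-HodgeAV-dual-g11` (planner, lens dual; claim-free; kit 0; pen ∕ Lean only) · token: line stmt-HodgeConjecture-18881
Cruxes/BlochSeedDiscOne/Lines/birth.lean 814a6a70c14e831a stub_rung_pad4_seedAt.  The landing-path note §1 OFFERED this delta; it turned out to be one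
farm cycle (rc 0 first try), so it is filed as a small ADD-ON MODULE importing `BnCCert` (the v7 checker is untouched; nothing else of the note is built;
R4 untouched).  Scratch-grade until the officer plates it.

WHY.  `BnCCert.valid` certifies the COVER («every value vector `ks ∈ {0..4}^|vars|` with `ks[0] ≥ 1` is matched by a leaf») by enumerating the cube —
`5^|vars|` vectors; s4's h = 6 class tree uses 15 statistics, so a full class-forest certificate cannot be checked that way.  The closed leaves come from a
BRANCH TREE (branch on one statistic, one child per value `0..4`), and that tree IS the cover certificate: `CTree` below, checked by `rootCoverT` in time
linear in the tree, with the SAME soundness conclusion as the cube (`rootCoverT_sound` ⇒ a matching leaf for every value vector), whence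
`region_coverT` ∕ `depthBound_of_validT` ∕ `floorFree_of_validT` — the v7 end-to-end theorems with `valid` replaced by `validT C t`
(floor variable literal ∧ every leaf `checkLeaf` ∧ tree cover).  Leaves keep FORMAT v1 unchanged (`cap = none` on the statistics not branched on the
leaf's path); nothing about the LP side changes.

HONEST FRAMING.  A checker-soundness theorem, not a certificate: NO certificate for `FloorFree 6 199 8` exists (s4's class tree has an open frontier);
`validT` is claimed for nothing real here (the `Smoke` section exercises the tree semantics on FAKE leaves only); census-neutral; letters ≠ designs ≠
sheaves ≠ SEED; nothing toward HC ∕ HC_CM ∕ HC_AV ∕ №4 ∕ 26512 ∕ 18881 ∕ H2.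
-/

set_option linter.dupNamespace false
set_option autoImplicit false

namespace Summit.HodgeConjecture.HodgeConjecture.Cruxes.BlochSeedDiscOne.BnCCertTree

open Summit.HodgeConjecture.HodgeConjecture.Cruxes.BlochSeedDiscOne.DepthBoundA4
open Summit.HodgeConjecture.HodgeConjecture.Cruxes.BlochSeedDiscOne.RingFiveEmpty
open Summit.HodgeConjecture.HodgeConjecture.Cruxes.BlochSeedDiscOne.BnCCert

/-! ## §1 The cover tree and its checker -/

/-- the cover tree: `leaf i` points at `C.leaves[i]`; `node q kids` branches statistic `q` into its values `0..4`, child `k` = `kids[k]` -/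
inductive CTree where
  | leaf (i : ℕ)
  | node (q : ℕ) (kids : List CTree)

/-- assign value `k` to variable `q` of a partial assignment (out of range: unchanged) -/
def setAt : List (Option ℕ) → ℕ → ℕ → List (Option ℕ)
  | [], _, _ => []
  | _ :: l, 0, k => some k :: l
  | a :: l, q + 1, k => a :: setAt l q k

/-- the tree cover check with fuel (a depth bound): under the partial assignment `asg`, the subtree accounts for every completion —
a leaf must carry EXACTLY the caps of the path (`cap = asg`, i.e. `none` on unbranched statistics); a node on `q` needs `q` in range and
five checked children. -/
def coverT (C : BnCCert) : CTree → ℕ → List (Option ℕ) → Bool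
  | .leaf i, _, asg =>
      match C.leaves[i]? with
      | some lf => decide (lf.recs.map VarRec.cap = asg)
      | none => false
  | .node _ _, 0, _ => false
  | .node q kids, fuel + 1, asg =>
      decide (q < asg.length) && decide (kids.length = 5) &&
        ((List.range 5).all fun k =>
          match kids[k]? with
          | some t => coverT C t fuel (setAt asg q k)
          | none => false)

/-- the ROOT check: variable 0 is the floor statistic and only value vectors with `ks[0] ≥ 1` must be covered (v1's exemption), so a root node on
statistic 0 may leave its value-0 child unchecked; any other root is checked in full.  Fuel = `|vars|` (each statistic is branched at most once on a path). -/
def rootCoverT (C : BnCCert) (t : CTree) : Bool :=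
  match t with
  | .node 0 kids =>
      decide (0 < C.vars.length) && decide (kids.length = 5) &&
        ((List.range 5).all fun k => decide (k = 0) ||
          match kids[k]? with
          | some s => coverT C s C.vars.length (setAt (List.replicate C.vars.length none) 0 k)
          | none => false)
  | _ => coverT C t C.vars.length (List.replicate C.vars.length none)

/-- **the tree-cover checker**: floor variable literal, every leaf passes `checkLeaf`, and the tree covers. -/
def validT (C : BnCCert) (t : CTree) : Bool :=
  decide (C.vars[0]? = some ⟨Side.P, floorStat C.h⟩) &&
  (C.leaves.all fun lf => checkLeaf C lf) &&
  rootCoverT C t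

/-! ## §2 Soundness of the tree cover: every value vector is matched by a leaf -/

@[simp] theorem length_setAt : ∀ (l : List (Option ℕ)) (q k : ℕ), (setAt l q k).length = l.length
  | [], _, _ => rfl
  | _ :: _, 0, _ => rfl
  | a :: l, q + 1, k => by simp [setAt, length_setAt l q k]

theorem getElem?_setAt_self : ∀ (l : List (Option ℕ)) (q k : ℕ), q < l.length → (setAt l q k)[q]? = some (some k)
  | [], q, k, h => by simp at h
  | _ :: l, 0, k, _ => by simp [setAt]
  | a :: l, q + 1, k, h => by
      simp only [setAt, List.getElem?_cons_succ]
      exact getElem?_setAt_self l q k (by simpa using h)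

theorem getElem?_setAt_ne : ∀ (l : List (Option ℕ)) (q k i : ℕ), i ≠ q → (setAt l q k)[i]? = l[i]?
  | [], _, _, _, _ => by simp [setAt]
  | _ :: l, 0, k, i, h => by
      cases i with
      | zero => exact absurd rfl h
      | succ i => simp [setAt]
  | a :: l, q + 1, k, i, h => by
      cases i with
      | zero => simp [setAt]
      | succ i =>
          simp only [setAt, List.getElem?_cons_succ]
          exact getElem?_setAt_ne l q k i (fun e => h (by omega))

/-! A partial assignment `asg` AGREES with a total value vector `ks` when `asg.length = ks.length ∧ ∀ i k, asg[i]? = some (some k) → ks[i]? = some k`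
(spelled out in each statement; no auxiliary `Prop` definition). -/

theorem agrees_replicate (ks : List ℕ) :
    ((List.replicate ks.length (none : Option ℕ)).length = ks.length ∧ ∀ j m : ℕ, (List.replicate ks.length (none : Option ℕ))[j]? = some (some m) → ks[j]? = some m) :=
  ⟨by simp, fun _ _ h => absurd (List.eq_of_mem_replicate (List.mem_of_getElem? h)) (by simp)⟩

theorem agrees_setAt {asg : List (Option ℕ)} {ks : List ℕ}
    (h : (asg.length = ks.length ∧ ∀ j m : ℕ, asg[j]? = some (some m) → ks[j]? = some m)) {q k : ℕ} (hk : ks[q]? = some k) :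
    ((setAt asg q k).length = ks.length ∧ ∀ j m : ℕ, (setAt asg q k)[j]? = some (some m) → ks[j]? = some m) := by
  refine ⟨by rw [length_setAt]; exact h.1, fun i k' hi => ?_⟩
  by_cases hiq : i = q
  · subst hiq
    have hq : i < asg.length := by
      rw [h.1]
      by_contra hc
      rw [List.getElem?_eq_none_iff.mpr (Nat.le_of_not_lt hc)] at hk
      simp at hk
    rw [getElem?_setAt_self asg i k hq] at hi
    simp only [Option.some.injEq] at hi
    subst hi
    exact hk
  · rw [getElem?_setAt_ne asg q k i hiq] at hi
    exact h.2 i k' hi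

theorem matchesB_of_agrees {caps : List (Option ℕ)} {ks : List ℕ}
    (h : (caps.length = ks.length ∧ ∀ j m : ℕ, caps[j]? = some (some m) → ks[j]? = some m)) : matchesB caps ks = true := by
  unfold matchesB
  refine List.all_eq_true.mpr fun ck hck => ?_
  obtain ⟨i, hi⟩ := List.mem_iff_getElem?.mp hck
  have hz := List.getElem?_zip_eq_some.mp hi
  obtain ⟨c, k⟩ := ck
  cases c with
  | none => simp
  | some c =>
      have hks := h.2 i c hz.1
      rw [hz.2] at hks
      simp only [Option.some.injEq] at hks
      subst hks
      simp

/-- the tree cover is SOUND: a checked subtree under an assignment agreeing with `ks` contains a leaf matching `ks` -/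
theorem coverT_sound (C : BnCCert) (ks : List ℕ) (hks : ∀ k ∈ ks, k < 5) :
    ∀ (fuel : ℕ) (t : CTree) (asg : List (Option ℕ)), coverT C t fuel asg = true →
      (asg.length = ks.length ∧ ∀ j m : ℕ, asg[j]? = some (some m) → ks[j]? = some m) →
      ∃ lf ∈ C.leaves, matchesB (lf.recs.map VarRec.cap) ks = true := by
  have hleaf : ∀ (fuel i : ℕ) (asg : List (Option ℕ)), coverT C (.leaf i) fuel asg = true →
      (asg.length = ks.length ∧ ∀ j m : ℕ, asg[j]? = some (some m) → ks[j]? = some m) →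
      ∃ lf ∈ C.leaves, matchesB (lf.recs.map VarRec.cap) ks = true := by
    intro fuel i asg h hag
    rcases hi : C.leaves[i]? with _ | lf
    · simp [coverT, hi] at h
    · simp only [coverT, hi, decide_eq_true_eq] at h
      subst h
      exact ⟨lf, List.mem_of_getElem? hi, matchesB_of_agrees hag⟩
  intro fuel
  induction fuel with
  | zero =>
      intro t asg h hag
      cases t with
      | leaf i => exact hleaf 0 i asg h hag
      | node q kids => simp [coverT] at h
  | succ n ih =>
      intro t asg h hag
      cases t with
      | leaf i => exact hleaf (n + 1) i asg h hag
      | node q kids =>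
          simp only [coverT, Bool.and_eq_true, decide_eq_true_eq, List.all_eq_true] at h
          obtain ⟨⟨hq, hlen5⟩, hall⟩ := h
          have hqk : q < ks.length := by rw [← hag.1]; exact hq
          obtain ⟨k, hk⟩ : ∃ k, ks[q]? = some k := ⟨ks[q], List.getElem?_eq_getElem hqk⟩
          have hk5 : k < 5 := hks k (List.mem_of_getElem? hk)
          have hs := hall k (List.mem_range.mpr hk5)
          obtain ⟨s, hsk⟩ : ∃ s, kids[k]? = some s := ⟨kids[k]'(by omega), List.getElem?_eq_getElem (by omega)⟩
          simp only [hsk] at hs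
          exact ih s (setAt asg q k) hs (agrees_setAt hag hk)

/-- the ROOT cover is sound for every value vector with `ks[0] ≠ 0` -/
theorem rootCoverT_sound (C : BnCCert) (t : CTree) (ks : List ℕ) (h : rootCoverT C t = true)
    (hlen : ks.length = C.vars.length) (hks : ∀ k ∈ ks, k < 5) (hk0 : ks.getD 0 0 ≠ 0) :
    ∃ lf ∈ C.leaves, matchesB (lf.recs.map VarRec.cap) ks = true := by
  have hag0 : ((List.replicate C.vars.length (none : Option ℕ)).length = ks.length ∧ ∀ j m : ℕ, (List.replicate C.vars.length (none : Option ℕ))[j]? = some (some m) → ks[j]? = some m) := by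
    exact ⟨by simp [hlen], fun _ _ h => absurd (List.eq_of_mem_replicate (List.mem_of_getElem? h)) (by simp)⟩
  cases t with
  | leaf i =>
      simp only [rootCoverT] at h
      exact coverT_sound C ks hks _ _ _ h hag0
  | node q kids =>
      cases q with
      | succ q =>
          simp only [rootCoverT] at h
          exact coverT_sound C ks hks _ _ _ h hag0
      | zero =>
          simp only [rootCoverT, Bool.and_eq_true, decide_eq_true_eq, List.all_eq_true, Bool.or_eq_true] at h
          obtain ⟨⟨hn, hlen5⟩, hall⟩ := h
          cases ks with
          | nil => simp at hlen; omega
          | cons a tl =>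
              simp only [List.getD_cons_zero] at hk0
              have hk5 : a < 5 := hks a (by simp)
              have hs := hall a (List.mem_range.mpr hk5)
              rcases hs with hbad | hs
              · exact absurd hbad hk0
              obtain ⟨s, hsk⟩ : ∃ s, kids[a]? = some s := ⟨kids[a]'(by omega), List.getElem?_eq_getElem (by omega)⟩
              simp only [hsk] at hs
              exact coverT_sound C (a :: tl) hks _ _ _ hs (agrees_setAt hag0 (k := a) (q := 0) rfl)

/-! ## §3 The end-to-end theorems with the tree cover (v7's `region_cover` ∕ `depthBound_of_valid'` ∕ `depthBound_of_valid` ∕ `floorFree_of_valid`, cube ↦ tree) -/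

/-- (S1 ∧ S2 ⇒) every admissible design with a floor letter lies in the region of some leaf of a tree-valid certificate -/
theorem region_coverT (C : BnCCert) (t : CTree) (hv : validT C t = true) (D : Design) (hA : D.OnAlphabet C.h) (h4 : D.A4)
    (c : Cell) (hc : c ∈ D.suppN ++ D.suppP) (f : Fin 4) (hfloor : (c f).a = 0) :
    ∃ lf ∈ C.leaves, InRegion C.vars lf D ∧
      (∀ sd : Side, ∀ c' ∈ suppSide D sd, admType C.h (allBounds C.vars lf) sd (typeOf c') = true) := by
  have hv' := hv
  unfold validT at hv'
  simp only [Bool.and_eq_true, decide_eq_true_eq] at hv'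
  obtain ⟨⟨hv0, hleaves⟩, hroot⟩ := hv'
  have hS1 := static_adm C.h D hA h4
  -- the floor cell is a P-cell (nothing lies amply below level 0)
  have hcP : c ∈ D.suppP := by
    rcases List.mem_append.mp hc with hcN | hcP
    · exfalso
      obtain ⟨x, hx, hlive⟩ := h4.2 c hcN
      have hlt := (hlive f).1
      have hx0 := (hA x (List.mem_append.mpr (Or.inr hx)) f).2
      omega
    · exact hcP
  -- the value vector of the design
  have hks5 : ∀ k ∈ C.vars.map (kOf D), k < 5 := fun k hk => by
    obtain ⟨v, _, rfl⟩ := List.mem_map.mp hk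
    exact Nat.lt_succ_of_le (kOf_le_four D v)
  -- variable 0 (the P-floor count) is positive on this design
  have hk0 : (C.vars.map (kOf D)).getD 0 0 ≠ 0 := by
    cases hvars : C.vars with
    | nil => rw [hvars] at hv0; simp at hv0
    | cons v0 rest =>
      rw [hvars] at hv0
      simp only [List.getElem?_cons_zero, Option.some.injEq] at hv0
      subst hv0
      simp only [List.map_cons, List.getD_cons_zero]
      have hcnt : 0 < (floorStat C.h).count (typeOf c) := by
        unfold Stat.count
        refine List.length_pos_of_mem (List.mem_filter.mpr ⟨List.mem_finRange f, ?_⟩)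
        refine List.elem_eq_true_of_mem (List.mem_filter.mpr ⟨by rw [admP0T_eq]; exact hS1.1 c hcP f, ?_⟩)
        simp [Shape.isFloor, shapeOf, typeOf, hfloor]
      have hle : (floorStat C.h).count (typeOf c) ≤ kOf D ⟨Side.P, floorStat C.h⟩ :=
        (isMax_kOf D ⟨Side.P, floorStat C.h⟩).1 c hcP
      omega
  -- the matching leaf, from the TREE cover
  obtain ⟨lf, hlf, hmatch⟩ := rootCoverT_sound C t (C.vars.map (kOf D)) hroot (by simp) hks5 hk0
  -- the design is in the leaf's region
  have hreg : InRegion C.vars lf D := by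
    intro e he k hk
    obtain ⟨i, hi⟩ := List.mem_iff_getElem?.mp he
    have hvr := List.getElem?_zip_eq_some.mp hi
    have hz : (List.zip (lf.recs.map VarRec.cap) (C.vars.map (kOf D)))[i]? = some (e.2.cap, kOf D e.1) := by
      apply List.getElem?_zip_eq_some.mpr
      rw [List.getElem?_map, hvr.2, List.getElem?_map, hvr.1]
      exact ⟨rfl, rfl⟩
    unfold matchesB at hmatch
    have hm := List.all_eq_true.mp hmatch _ (List.mem_of_getElem? hz)
    simp only [hk, decide_eq_true_eq] at hm
    rw [hm]
    exact isMax_kOf D e.1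
  -- admissibility from the leaf's derived-bound check
  have hchk : checkLeaf C lf = true := List.all_eq_true.mp hleaves lf hlf
  have hder : checkDerivedAll C.h (primaryBounds (ents C.vars lf)) lf.derived = true := by
    simp only [checkLeaf, Bool.and_eq_true, decide_eq_true_eq] at hchk
    obtain ⟨⟨⟨⟨⟨⟨⟨⟨_, hder⟩, _⟩, _⟩, _⟩, _⟩, _⟩, _⟩, _⟩ := hchk
    exact hder
  exact ⟨lf, hlf, hreg, adm_of_region C lf hder D hA h4 hreg⟩

/-- soundness with the tree cover, parametrised by a provider of the parity conclusions (as v7's `depthBound_of_valid'`) -/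
theorem depthBound_of_validT' (C : BnCCert) (t : CTree) (hv : validT C t = true)
    (hpar : ∀ lf ∈ C.leaves, ∀ D : Design, D.A1 →
      (∀ sd : Side, ∀ c' ∈ suppSide D sd, admType C.h (allBounds C.vars lf) sd (typeOf c') = true) → ParityOK C lf D) :
    DepthBound C.h C.B C.rmin ((C.h : ℤ) - 1) := by
  intro D hA h1 h4 _hμ hB hr c hc f
  by_contra hlt
  have hh := (hA c hc f).1
  have ha0 := (hA c hc f).2
  unfold Letter.height at hh
  unfold Letter.colevel at hlt
  have hfloor : (c f).a = 0 := by
    push Not at hlt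
    have habs : 0 ≤ |(c f).x| + |(c f).y| := by positivity
    omega
  have hleaves : C.leaves.all (fun lf => checkLeaf C lf) = true := by
    have hv' := hv
    unfold validT at hv'
    simp only [Bool.and_eq_true] at hv'
    exact hv'.1.2
  have hsides : D.suppN ≠ [] ∧ D.suppP ≠ [] := by
    rcases List.mem_append.mp hc with hcN | hcP
    · obtain ⟨x, hx, _⟩ := h4.2 c hcN
      exact ⟨List.ne_nil_of_mem hcN, List.ne_nil_of_mem hx⟩
    · obtain ⟨y, hy, _⟩ := h4.1 c hcP
      exact ⟨List.ne_nil_of_mem hy, List.ne_nil_of_mem hcP⟩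
  obtain ⟨lf, hlf, hreg, hadm⟩ := region_coverT C t hv D hA h4 c hc f hfloor
  have hchk : checkLeaf C lf = true := List.all_eq_true.mp hleaves lf hlf
  exact leaf_sound C lf hchk D h1 hB hr hsides.1 hsides.2 hreg hadm (hpar lf hlf D h1 hadm)

/-- **SOUNDNESS (depth form) with the TREE cover** — as v7's `depthBound_of_valid`, discharging parity with (S4) `parity_even`. -/
theorem depthBound_of_validT (C : BnCCert) (t : CTree) (hv : validT C t = true) : DepthBound C.h C.B C.rmin ((C.h : ℤ) - 1) :=
  depthBound_of_validT' C t hv fun lf _ D h1 hadm e _ k _ _ he => parity_even C lf e.1 k e.2.par he D h1 hadm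

/-- **SOUNDNESS (floor form) with the TREE cover:** `validT C t ⇒ FloorFree h B rmin`. -/
theorem floorFree_of_validT (C : BnCCert) (t : CTree) (hv : validT C t = true) : FloorFreeH C.h C.B C.rmin := by
  intro D hA h1 h4 hμ hB hr c hc f
  have hcl := depthBound_of_validT C t hv D hA h1 h4 hμ hB hr c hc f
  have hh := (hA c hc f).1
  unfold Letter.height at hh
  unfold Letter.colevel at hcl
  linarith

/-! ## §4 Smoke test of the tree semantics (FAKE leaves — caps only; nothing about LPs or designs) -/
section Smoke

/-- a fake leaf carrying only a caps pattern -/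
def fakeLeaf (caps : List (Option ℕ)) : Leaf :=
  {recs := caps.map fun c => ⟨c, 0, 0, []⟩, derived := [], func := Func.cls ⟨0, 0, 0, 0, 0, 0⟩, L := 0, ρ := 0, laws := []}

/-- two variables; leaves: FLOOR = 1, 3, 4 unbranched in variable 1; FLOOR = 2 branched on variable 1 into its five values -/
def fakeC : BnCCert :=
  {h := 6, B := 199, rmin := 8, vars := [⟨Side.P, floorStat 6⟩, ⟨Side.P, floorStat 6⟩],
   leaves := [fakeLeaf [some 1, none], fakeLeaf [some 3, none], fakeLeaf [some 4, none],
              fakeLeaf [some 2, some 0], fakeLeaf [some 2, some 1], fakeLeaf [some 2, some 2], fakeLeaf [some 2, some 3], fakeLeaf [some 2, some 4]]}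

/-- the branch tree: root on variable 0 (value 0 exempt), value 2 re-branched on variable 1 -/
def fakeT : CTree := .node 0 [.leaf 0, .leaf 0, .node 1 [.leaf 3, .leaf 4, .leaf 5, .leaf 6, .leaf 7], .leaf 1, .leaf 2]

example : rootCoverT fakeC fakeT = true := by decide
/-- a wrong tree (value 2 sent to a leaf whose caps do not match the path) is rejected -/
example : rootCoverT fakeC (.node 0 [.leaf 0, .leaf 0, .leaf 3, .leaf 1, .leaf 2]) = false := by decide
/-- a tree missing the re-branch's value-4 child is rejected -/
example : rootCoverT fakeC (.node 0 [.leaf 0, .leaf 0, .node 1 [.leaf 3, .leaf 4, .leaf 5, .leaf 6], .leaf 1, .leaf 2]) = false := by decide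

end Smoke

end Summit.HodgeConjecture.HodgeConjecture.Cruxes.BlochSeedDiscOne.BnCCertTree
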